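/-
Copyright (c) 2026 the pub-hodgecm-mathlib formalisation cell (harness21).  Prover seat hodgecm-mathlib-F0P2-p09 (g0), re-dealt to L1
`stub_firstTermThetaPairing` (director s1969∕s1970); hLiu418 = `stmt-HodgeConjecture-24832`; I4-conv (F′-fact), the LOCAL BRIDGE between ★ D0 and FILE B.
-/
import Literature.NumberTheory.Automorphic.UnitaryGroupSymplecticLocalization        -- ★ `adeleToLocal_quadraticAdeleEquiv` (+ `QuadraticAdeleBaseChange`, `QuadraticLocalBaseChange`)
import Literature.NumberTheory.Automorphic.UnitaryGroupTraceZeroLine                 -- ★ `fst_quadraticAdeleEquiv_symm_eq_zero`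
import Literature.NumberTheory.GelbartRogawski1991.DoubledUnitaryGlobalSplittingData   -- ★ `Fp L = L⁺`
import Literature.NumberTheory.Automorphic.AdelicSecondCountable                      -- ★ `secondCountableTopology_adicCompletion`
import Mathlib.MeasureTheory.Group.Measure
import Mathlib.MeasureTheory.Integral.Bochner.Basic
import HarnessLib

/-!
# Crux `HLiu418`, I4-conv (F′-fact) — `K2LiuKlingenFibreLocalCoordinates`: THE LOCAL QUADRATIC COORDINATES `L⁺_v³ ≃ₜ+ Y_v × L_v` OF THE KLINGEN FIBRE AT A
# FINITE PLACE `v` OF `L⁺`, their compatibility with ★ D0's global coordinates (`adeleToLocal` on both factors), integrality off a finite set, measure transport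

Cell `hodgecm-mathlib`, crux item hLiu418 = `stmt-HodgeConjecture-24832`; squad K2 ∕ K2Liu (re-dealt hand F0P2-p09 (g0)); LEAD F0P6-plan (g14); desk K2Liu-p14 (g3) (FILE B
`K2LiuKlingenInnerSectionLocalDefs` 📤 p861422: the local letters live on `Y_v × L_v`, `Y_v = skewLoc v = {y ∈ L_v | (σ ⊗ 1) y = −y}`, `L_v = Π_{w∣v} L_w`), ★ D0
`K2LiuKlingenFibreHaarPinned`∕`K2LiuKlingenFibreEulerProduct` (F0P2-p09: the fibre split over the places of `L⁺` with local carrier `Fin 3 → L⁺_v`).  THEOREMS ONLY (no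
`def`, no instance, no notation, no named-fact hypothesis, no `sorry`); lane `--supports stmt-HodgeConjecture-24832 --as helper`.  `Y_v` enters as ANY additive subgroup
`Yv ≤ L_v` with `hYv : y ∈ Yv ↔ (σ ⊗ 1) y = −y` (FILE B's `skewLoc v` ∕ `mem_skewLoc_iff` instantiate it), so this file does not import FILE B.

* §1 `adeleToLocal_mem_of_skew` — `y ∈ Y(𝔸) ⇒ y_v ∈ Y_v` (★ `adeleToLocal_conj`); `fst_quadraticLocalEquiv_symm_eq_zero_of_skew` — a skew `y ∈ L_v` has first quadratic coordinate `0`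
  (★ `conjLocal_quadraticLocalEquiv`; `L⁺_v` has characteristic `0`).
* §2 **`exists_localCoord`** — THE BRIDGE `θ_v : (Fin 3 → L⁺_v) ≃ₜ+ (↥Yv × L_v)`, `d ↦ (Ψ_v(0, d 0) ; Ψ_v(d 1, d 2))` with `Ψ_v = ★ quadraticLocalEquiv L v σ`
  [CasselsFrohlichANT1967, Ch. II §10], together with: (L2) COMPATIBILITY with ★ D0's coordinates — for `y ∈ Y(𝔸)`, `t ∈ 𝔸_L`:
  `θ_v ![(Ψ.symm y).2.2 v, (Ψ.symm t).1.2 v, (Ψ.symm t).2.2 v] = (y_v, t_v)` (`Ψ = ★ quadraticAdeleEquiv L⁺ L σ`; ★ `adeleToLocal_quadraticAdeleEquiv`), i.e. `θ_v ((E q).2 v) = ((q.1)_v, (q.2)_v)`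
  after ★ D0's coordinate clause; (L3) INTEGRALITY — if `|2|_v = 1` and `δ ∈ 𝒪_w^×` for all `w ∣ v` then `θ_v '' 𝒪_v³ = {(y, t) | y, t integral above v}` (★
  `coords_mem_adicCompletionIntegers`, ★ `toLocalRing_mem_adicCompletionIntegers`; these conditions hold at almost all `v`, ★ `eventually_valued_algebraMap_eq_one`).
* §3 `integral_comp_eq_of_map_symm` — MEASURE TRANSPORT (L4): for any such `θ` and any measure `m` on `↥Yv × L_v`, `∫ d, G (θ d) d(m ∘ θ) = ∫ q, G q dm`, `(m ∘ θ)(s) = m (θ '' s)`,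
  and `m ∘ θ := m.map θ.symm` is an additive Haar measure when `m` is — so FILE E sets ★ D0's `ν_v := (ν_{Y,v} ⊗ ν_{T,v}).map θ_v.symm` and `φ_v := G_v ∘ θ_v` and gets
  `∫ φ_v dν_v = ∫ G_v d(ν_{Y,v} ⊗ ν_{T,v}) = J_v` on the nose.
HONEST LABEL.  Count-neutral helper: `HC_CM` is proved only modulo the 7 printed citations (2 remaining named inputs: hLiu418 = `stmt-HodgeConjecture-24832`,
h413 = `stmt-HodgeConjecture-24833`) until rung 0 closes; this file closes no socket by itself.

## Mathlib ∕ tree search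
Tree ★: `quadraticLocalEquiv{,_apply}`, `conjLocal_quadraticLocalEquiv`, `adeleToLocal_quadraticAdeleEquiv`, `adeleToLocal_conj`, `fst_quadraticAdeleEquiv_symm_eq_zero`,
`coords_mem_adicCompletionIntegers`, `toLocalRing_mem_adicCompletionIntegers`.  Mathlib: `Continuous.matrixVecCons`, `ContinuousLinearEquiv.continuous`, `ContinuousAddEquiv.isAddHaarMeasure_map`,
`MeasureTheory.integral_map_equiv`, `Equiv.image_eq_preimage_symm`.  Dedup: `rg "localCoord|skew.*quadraticLocalEquiv" Summits/` — none.

## References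
* [CasselsFrohlichANT1967] J. W. S. Cassels, A. Fröhlich (eds.), *Algebraic Number Theory* (1967), Ch. II (Cassels) §10, §14; Ch. XV (Tate) §3.3.
* [BorelJacquet1979] A. Borel, H. Jacquet, *Automorphic forms and automorphic representations*, PSPM 33.1 (1979), §4.1.
-/

set_option autoImplicit false
set_option linter.dupNamespace false -- the mandated namespace repeats `HodgeConjecture.HodgeConjecture`

noncomputable section

open scoped ENNReal NNReal Topology
open NumberField IsDedekindDomain MeasureTheory Measure Filter Set

namespace Summit.HodgeConjecture.HodgeConjecture.Cruxes.HLiu418.K2LiuKlingenFibreLocalCoordinates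

open Literature.NumberTheory.Automorphic Literature.NumberTheory.Automorphic.UnitaryGroup
open Literature.NumberTheory.GelbartRogawski1991.GRConstruction (Fp)

variable (L : Type) [Field L] [NumberField L] [IsCMField L] (v : HeightOneSpectrum (𝓞 (Fp L)))

/-! ## §1 Skew adeles read at a place -/

/-- `y ∈ Y(𝔸)` (skew) ⇒ `y_v ∈ Y_v` (skew above `v`): `(σ ⊗ 1)` commutes with `adeleToLocal` (★ `adeleToLocal_conj`). [cite: CasselsFrohlichANT1967, Ch. II §14] -/
theorem adeleToLocal_mem_of_skew (Y : AddSubgroup (AdeleRing (𝓞 L) L)) (hY : ∀ y, y ∈ Y ↔ conjAdele (Fp L) L (IsCMField.complexConj L) y = -y)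
    (Yv : AddSubgroup (LocalRing L v)) (hYv : ∀ y, y ∈ Yv ↔ conjLocal L (IsCMField.complexConj L) v y = -y) (y : ↥Y) :
    adeleToLocal L v (y : AdeleRing (𝓞 L) L) ∈ Yv := by
  refine (hYv _).2 ?_
  rw [← adeleToLocal_conj, (hY _).1 y.2, map_neg]

/-- a skew element of `L_v` has vanishing first quadratic coordinate: `(σ ⊗ 1) y = −y ⇒ y = Ψ_v(0, b)` (★ `conjLocal_quadraticLocalEquiv`; `char L⁺_v = 0`).
[cite: CasselsFrohlichANT1967, Ch. II §10] -/
theorem fst_quadraticLocalEquiv_symm_eq_zero_of_skew {δ : L} (hσδ : IsCMField.complexConj L δ = -δ) (hδ : δ ≠ 0)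
    {y : LocalRing L v} (hy : conjLocal L (IsCMField.complexConj L) v y = -y) :
    ((quadraticLocalEquiv L v (IsCMField.complexConj L) hσδ hδ).symm y).1 = 0 := by
  haveI : CharZero (v.adicCompletion (Fp L)) := charZero_of_injective_algebraMap (algebraMap (Fp L) (v.adicCompletion (Fp L))).injective
  set p := (quadraticLocalEquiv L v (IsCMField.complexConj L) hσδ hδ).symm y with hp
  have hyp : y = quadraticLocalEquiv L v (IsCMField.complexConj L) hσδ hδ (p.1, p.2) := by
    rw [Prod.mk.eta, hp, ContinuousLinearEquiv.apply_symm_apply]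
  have h1 : conjLocal L (IsCMField.complexConj L) v y = quadraticLocalEquiv L v (IsCMField.complexConj L) hσδ hδ (p.1, -p.2) := by
    rw [hyp, conjLocal_quadraticLocalEquiv]
  have h2 : -y = quadraticLocalEquiv L v (IsCMField.complexConj L) hσδ hδ (-p.1, -p.2) := by
    rw [hyp, ← map_neg, Prod.neg_mk]
  have h3 : quadraticLocalEquiv L v (IsCMField.complexConj L) hσδ hδ (p.1, -p.2) =
      quadraticLocalEquiv L v (IsCMField.complexConj L) hσδ hδ (-p.1, -p.2) := by rw [← h1, hy, h2]
  have h4 : p.1 = -p.1 := congrArg Prod.fst ((quadraticLocalEquiv L v (IsCMField.complexConj L) hσδ hδ).injective h3)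
  have h5 : p.1 + p.1 = 0 := by
    nth_rw 2 [h4]
    exact add_neg_cancel p.1
  exact add_self_eq_zero.mp h5

/-! ## §2 The local quadratic coordinates `θ_v : L⁺_v³ ≃ₜ+ Y_v × L_v` and their compatibility with the global ones -/

/-- **THE LOCAL BRIDGE.**  For a finite place `v` of `L⁺`, `δ ∈ L` with `σ δ = −δ ≠ 0`, and ANY `Yv ≤ L_v = Π_{w∣v} L_w` with `y ∈ Yv ↔ (σ ⊗ 1) y = −y`:
there is an isomorphism of topological groups `θ : (Fin 3 → L⁺_v) ≃ₜ+ ↥Yv × L_v`, `θ d = (Ψ_v(0, d 0) ; Ψ_v(d 1, d 2))` (`Ψ_v = quadraticLocalEquiv L v σ`, `(a, b) ↦ ι_v a + ι_v b·δ`),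
with inverse `(y, t) ↦ ![(Ψ_v⁻¹ y).2, (Ψ_v⁻¹ t).1, (Ψ_v⁻¹ t).2]`, such that
(L2) for every skew `y ∈ Y(𝔸)` and `t ∈ 𝔸_L`, `θ ![(Ψ⁻¹ y)₂|_v, (Ψ⁻¹ t)₁|_v, (Ψ⁻¹ t)₂|_v] = (y_v, t_v)` (`Ψ = quadraticAdeleEquiv L⁺ L σ`; `·|_v` the `v`-component of the finite part,
`y_v = adeleToLocal v y`) — the triple on the left is ★ D0 `K2LiuKlingenFibreHaarPinned`'s coordinate `(E (y, t)).2 v`;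
(L3) if `|2|_v = 1` and `|δ|_w = 1` for all `w ∣ v`, then `θ '' 𝒪_v³` is the set of pairs `(y, t)` integral above `v`.
[cite: CasselsFrohlichANT1967, Ch. II §10, §14] [cite: BorelJacquet1979, §4.1] -/
theorem exists_localCoord {δ : L} (hσδ : IsCMField.complexConj L δ = -δ) (hδ : δ ≠ 0)
    (Yv : AddSubgroup (LocalRing L v)) (hYv : ∀ y, y ∈ Yv ↔ conjLocal L (IsCMField.complexConj L) v y = -y) :
    ∃ θ : (Fin 3 → v.adicCompletion (Fp L)) ≃ₜ+ (↥Yv × LocalRing L v),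
      (∀ d, ((θ d).1 : LocalRing L v) = quadraticLocalEquiv L v (IsCMField.complexConj L) hσδ hδ (0, d 0)) ∧
      (∀ d, (θ d).2 = quadraticLocalEquiv L v (IsCMField.complexConj L) hσδ hδ (d 1, d 2)) ∧
      (∀ q, θ.symm q = ![((quadraticLocalEquiv L v (IsCMField.complexConj L) hσδ hδ).symm (q.1 : LocalRing L v)).2,
        ((quadraticLocalEquiv L v (IsCMField.complexConj L) hσδ hδ).symm q.2).1,
        ((quadraticLocalEquiv L v (IsCMField.complexConj L) hσδ hδ).symm q.2).2]) ∧
      (∀ (Y : AddSubgroup (AdeleRing (𝓞 L) L)) (hY : ∀ y, y ∈ Y ↔ conjAdele (Fp L) L (IsCMField.complexConj L) y = -y) (y : ↥Y) (t : AdeleRing (𝓞 L) L),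
        θ ![((quadraticAdeleEquiv (Fp L) L (IsCMField.complexConj L) hσδ hδ).symm (y : AdeleRing (𝓞 L) L)).2.2 v,
            ((quadraticAdeleEquiv (Fp L) L (IsCMField.complexConj L) hσδ hδ).symm t).1.2 v,
            ((quadraticAdeleEquiv (Fp L) L (IsCMField.complexConj L) hσδ hδ).symm t).2.2 v] =
          (⟨adeleToLocal L v (y : AdeleRing (𝓞 L) L), adeleToLocal_mem_of_skew L v Y hY Yv hYv y⟩, adeleToLocal L v t)) ∧
      (Valued.v ((2 : Fp L) : v.adicCompletion (Fp L)) = 1 →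
        (∀ w : PlacesOver L v, Valued.v (algebraMap L (w.1.adicCompletion L) δ) = 1) →
        θ '' ((AddSubgroup.pi Set.univ (fun _ : Fin 3 => (v.adicCompletionIntegers (Fp L)).toSubring.toAddSubgroup) :
            AddSubgroup (Fin 3 → v.adicCompletion (Fp L))) : Set (Fin 3 → v.adicCompletion (Fp L))) =
          {q | (∀ w : PlacesOver L v, (q.1 : LocalRing L v) w ∈ w.1.adicCompletionIntegers L) ∧
            ∀ w : PlacesOver L v, q.2 w ∈ w.1.adicCompletionIntegers L}) := by
  set Ψv := quadraticLocalEquiv L v (IsCMField.complexConj L) hσδ hδ with hΨv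
  have hmem : ∀ b : v.adicCompletion (Fp L), Ψv (0, b) ∈ Yv := fun b => by
    refine (hYv _).2 ?_
    rw [hΨv, conjLocal_quadraticLocalEquiv, ← map_neg, Prod.neg_mk, neg_zero]
  have h0 : ∀ y : ↥Yv, (Ψv.symm (y : LocalRing L v)).1 = 0 := fun y =>
    fst_quadraticLocalEquiv_symm_eq_zero_of_skew L v hσδ hδ ((hYv _).1 y.2)
  -- the bridge as an additive homeomorphism
  let θ : (Fin 3 → v.adicCompletion (Fp L)) ≃ₜ+ (↥Yv × LocalRing L v) :=
    { toFun := fun d => (⟨Ψv (0, d 0), hmem (d 0)⟩, Ψv (d 1, d 2))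
      invFun := fun q => ![(Ψv.symm (q.1 : LocalRing L v)).2, (Ψv.symm q.2).1, (Ψv.symm q.2).2]
      left_inv := fun d => by
        funext i
        fin_cases i
        · show (Ψv.symm (Ψv (0, d 0))).2 = d 0
          rw [ContinuousLinearEquiv.symm_apply_apply]
        · show (Ψv.symm (Ψv (d 1, d 2))).1 = d 1
          rw [ContinuousLinearEquiv.symm_apply_apply]
        · show (Ψv.symm (Ψv (d 1, d 2))).2 = d 2
          rw [ContinuousLinearEquiv.symm_apply_apply]
      right_inv := fun q => by
        refine Prod.ext (Subtype.ext ?_) ?_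
        · show Ψv (0, (Ψv.symm (q.1 : LocalRing L v)).2) = (q.1 : LocalRing L v)
          conv_rhs => rw [← Ψv.apply_symm_apply (q.1 : LocalRing L v)]
          rw [← h0 q.1]
        · show Ψv ((Ψv.symm q.2).1, (Ψv.symm q.2).2) = q.2
          rw [Prod.mk.eta, ContinuousLinearEquiv.apply_symm_apply]
      map_add' := fun d d' => by
        refine Prod.ext (Subtype.ext ?_) ?_
        · show Ψv (0, (d + d') 0) = Ψv (0, d 0) + Ψv (0, d' 0)
          rw [← map_add, Prod.mk_add_mk, add_zero, Pi.add_apply]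
        · show Ψv ((d + d') 1, (d + d') 2) = Ψv (d 1, d 2) + Ψv (d' 1, d' 2)
          rw [← map_add, Prod.mk_add_mk, Pi.add_apply, Pi.add_apply]
      continuous_toFun := by
        refine Continuous.prodMk (Continuous.subtype_mk ?_ _) ?_
        · exact Ψv.continuous.comp (continuous_const.prodMk (continuous_apply 0))
        · exact Ψv.continuous.comp ((continuous_apply 1).prodMk (continuous_apply 2))
      continuous_invFun := by
        have h1 : Continuous fun q : ↥Yv × LocalRing L v => Ψv.symm (q.1 : LocalRing L v) :=
          Ψv.symm.continuous.comp (continuous_subtype_val.comp continuous_fst)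
        have h2 : Continuous fun q : ↥Yv × LocalRing L v => Ψv.symm q.2 := Ψv.symm.continuous.comp continuous_snd
        exact (continuous_snd.comp h1).matrixVecCons ((continuous_fst.comp h2).matrixVecCons
          ((continuous_snd.comp h2).matrixVecCons continuous_const)) }
  refine ⟨θ, fun d => rfl, fun d => rfl, fun q => rfl, fun Y hY y t => ?_, fun h2 hδw => ?_⟩
  · -- (L2) compatibility with the global coordinates
    refine Prod.ext (Subtype.ext ?_) ?_
    · show Ψv (0, ((quadraticAdeleEquiv (Fp L) L (IsCMField.complexConj L) hσδ hδ).symm (y : AdeleRing (𝓞 L) L)).2.2 v) =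
        adeleToLocal L v (y : AdeleRing (𝓞 L) L)
      have hy0 := fst_quadraticAdeleEquiv_symm_eq_zero L (IsCMField.complexConj L) hσδ hδ ⟨(y : AdeleRing (𝓞 L) L), (hY _).1 y.2⟩
      conv_rhs => rw [← (quadraticAdeleEquiv (Fp L) L (IsCMField.complexConj L) hσδ hδ).apply_symm_apply (y : AdeleRing (𝓞 L) L),
        adeleToLocal_quadraticAdeleEquiv]
      rw [hΨv]
      congr 2
      change (0 : v.adicCompletion (Fp L)) = (((quadraticAdeleEquiv (Fp L) L (IsCMField.complexConj L) hσδ hδ).symm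
        ((⟨(y : AdeleRing (𝓞 L) L), (hY _).1 y.2⟩ : traceZeroAdele (Fp L) L (IsCMField.complexConj L)) : AdeleRing (𝓞 L) L)).1).2 v
      rw [hy0]
      rfl
    · show Ψv (((quadraticAdeleEquiv (Fp L) L (IsCMField.complexConj L) hσδ hδ).symm t).1.2 v,
          ((quadraticAdeleEquiv (Fp L) L (IsCMField.complexConj L) hσδ hδ).symm t).2.2 v) = adeleToLocal L v t
      conv_rhs => rw [← (quadraticAdeleEquiv (Fp L) L (IsCMField.complexConj L) hσδ hδ).apply_symm_apply t, adeleToLocal_quadraticAdeleEquiv]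
  · -- (L3) integrality
    ext q
    constructor
    · rintro ⟨d, hd, rfl⟩
      have hd' : ∀ i, d i ∈ v.adicCompletionIntegers (Fp L) := fun i => (AddSubgroup.mem_pi _).1 hd i (Set.mem_univ i)
      have hδint : ∀ w : PlacesOver L v, (algebraMap L (LocalRing L v) δ) w ∈ w.1.adicCompletionIntegers L := fun w => by
        show algebraMap L (w.1.adicCompletion L) δ ∈ w.1.adicCompletionIntegers L
        rw [HeightOneSpectrum.mem_adicCompletionIntegers, hδw w]
      refine ⟨fun w => ?_, fun w => ?_⟩
      · show (Ψv (0, d 0)) w ∈ w.1.adicCompletionIntegers L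
        rw [hΨv, quadraticLocalEquiv_apply, Pi.add_apply, Pi.mul_apply, map_zero, Pi.zero_apply, zero_add]
        exact mul_mem (toLocalRing_mem_adicCompletionIntegers L v (hd' 0) w) (hδint w)
      · show (Ψv (d 1, d 2)) w ∈ w.1.adicCompletionIntegers L
        rw [hΨv, quadraticLocalEquiv_apply, Pi.add_apply, Pi.mul_apply]
        exact add_mem (toLocalRing_mem_adicCompletionIntegers L v (hd' 1) w)
          (mul_mem (toLocalRing_mem_adicCompletionIntegers L v (hd' 2) w) (hδint w))
    · rintro ⟨hq1, hq2⟩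
      refine ⟨θ.symm q, ?_, θ.apply_symm_apply q⟩
      have hA : ∀ w : PlacesOver L v, (toLocalRing L v (Ψv.symm (q.1 : LocalRing L v)).1 +
          toLocalRing L v (Ψv.symm (q.1 : LocalRing L v)).2 * algebraMap L (LocalRing L v) δ) w ∈ w.1.adicCompletionIntegers L := fun w => by
        rw [← quadraticLocalEquiv_apply L v (IsCMField.complexConj L) hσδ hδ, ← hΨv, ContinuousLinearEquiv.apply_symm_apply]
        exact hq1 w
      have hB : ∀ w : PlacesOver L v, (toLocalRing L v (Ψv.symm q.2).1 +
          toLocalRing L v (Ψv.symm q.2).2 * algebraMap L (LocalRing L v) δ) w ∈ w.1.adicCompletionIntegers L := fun w => by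
        rw [← quadraticLocalEquiv_apply L v (IsCMField.complexConj L) hσδ hδ, ← hΨv, ContinuousLinearEquiv.apply_symm_apply]
        exact hq2 w
      have hcA := coords_mem_adicCompletionIntegers v (IsCMField.complexConj L) hσδ h2 hδw hA
      have hcB := coords_mem_adicCompletionIntegers v (IsCMField.complexConj L) hσδ h2 hδw hB
      refine (AddSubgroup.mem_pi _).2 fun i _ => ?_
      show θ.symm q i ∈ v.adicCompletionIntegers (Fp L)
      fin_cases i
      · exact hcA.2
      · exact hcB.1
      · exact hcB.2

/-! ## §3 Measure transport along the bridge -/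

omit [IsCMField L] in
/-- **MEASURE TRANSPORT ALONG `θ`.**  For an additive homeomorphism `θ : (Fin 3 → L⁺_v) ≃ₜ+ ↥Yv × L_v` and a measure `m` on `↥Yv × L_v`, the transported measure
`m ∘ θ := m.map θ.symm` on `Fin 3 → L⁺_v` satisfies `∫ d, G (θ d) d(m ∘ θ) = ∫ q, G q dm` for every `G`, `(m ∘ θ)(s) = m (θ '' s)` for measurable `s`, and is an additive Haar
measure when `m` is (Mathlib `integral_map_equiv`, `ContinuousAddEquiv.isAddHaarMeasure_map`) — so FILE E takes ★ D0's `ν_v := (ν_{Y,v} ⊗ ν_{T,v}).map θ_v.symm` and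
`φ_v := G_v ∘ θ_v` and gets `∫ φ_v dν_v = ∫ G_v d(ν_{Y,v} ⊗ ν_{T,v})` on the nose. [cite: BorelJacquet1979, §4.1] -/
theorem integral_comp_eq_of_map_symm
    [MeasurableSpace (v.adicCompletion (Fp L))] [BorelSpace (v.adicCompletion (Fp L))]
    [MeasurableSpace (LocalRing L v)] [BorelSpace (LocalRing L v)]
    (Yv : AddSubgroup (LocalRing L v)) (θ : (Fin 3 → v.adicCompletion (Fp L)) ≃ₜ+ (↥Yv × LocalRing L v))
    (m : Measure (↥Yv × LocalRing L v)) :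
    (∀ G : ↥Yv × LocalRing L v → ℂ, ∫ d, G (θ d) ∂(m.map θ.symm) = ∫ q, G q ∂m) ∧
      (∀ s, MeasurableSet s → (m.map θ.symm) s = m (θ '' s)) ∧
      (m.IsAddHaarMeasure → (m.map θ.symm).IsAddHaarMeasure) := by
  haveI : SecondCountableTopology (v.adicCompletion (Fp L)) := secondCountableTopology_adicCompletion (Fp L) v
  haveI : ∀ w : HeightOneSpectrum (𝓞 L), SecondCountableTopology (w.adicCompletion L) := fun w => secondCountableTopology_adicCompletion L w
  haveI : BorelSpace (↥Yv × LocalRing L v) := Prod.borelSpace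
  refine ⟨fun G => ?_, fun s hs => ?_, fun hm => ?_⟩
  · have h := integral_map_equiv θ.symm.toHomeomorph.toMeasurableEquiv (μ := m) (fun d => G (θ d))
    have hcoe : ⇑(θ.symm.toHomeomorph.toMeasurableEquiv) = ⇑θ.symm := rfl
    rw [hcoe] at h
    rw [h]
    exact integral_congr_ae (Eventually.of_forall fun q => by simp only [ContinuousAddEquiv.apply_symm_apply])
  · have hc : Continuous (θ.symm : ↥Yv × LocalRing L v → Fin 3 → v.adicCompletion (Fp L)) := θ.symm.continuous
    rw [Measure.map_apply hc.measurable hs]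
    congr 1
    exact (θ.toEquiv.image_eq_preimage_symm s).symm
  · haveI := hm
    exact θ.symm.isAddHaarMeasure_map m

end Summit.HodgeConjecture.HodgeConjecture.Cruxes.HLiu418.K2LiuKlingenFibreLocalCoordinates

end
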